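import Literature.NumberTheory.Automorphic.UnitaryBlockScalarFrameFacts            -- ⊙ A1: frame vector facts (anisotropy, eigenvalues of centraliser elements, `Stab(v₁) ≤ Z(ε)`)
import Literature.NumberTheory.Automorphic.UnitaryConjugacyCompactModStabilizer     -- ★ p841422 (F-asm): compact mod `Stab(v₁)` under an abstract window
import Literature.NumberTheory.Automorphic.UnitarySliceDatum                        -- ★ p840996 (D1c): compact-open neighbourhoods of `ε` in `Z_U(ε)` (box clause)
import Literature.LinearAlgebra.Matrix.RegularSemisimpleConjClassClosed             -- ★ `continuous_charpoly_coeff`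
import HarnessLib

/-!
# «COMPACT MODULO THE CENTRALISER» at a block-scalar unitary `ε = P(a·1 ⊕ u)P⁻¹` — the WINDOW made internal: a compact-open `B₁ ∋ ε` in `Z_U(ε)` such that for every compact `Ω`
# the conjugators `x` with `x t x⁻¹ ∈ Ω` for some `t ∈ B₁` lie in `C · Z_U(ε)`, `C` compact (N6nsGerm (S1)∕(S2), binder (B4-top)(3), field level, FILE A2)

Topic `NumberTheory/Automorphic`; namespace `Literature.NumberTheory.Automorphic.UnitaryGroup`. KERNEL ONLY: one theorem (+ private helpers), no definition, no named fact,
no instance, no notation, no `sorry`.  Cell `pub/hodgecm-mathlib` (LEAD F0P3a-plan (g9) T8-38 (1); road «N6nsGerm», p08 (g13) «=» 05:43:27Z on the shape (q2)(q3)).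

THE MATHEMATICS.  `E` a complete proper totally disconnected non-trivially normed field of characteristic `0` (the `L_w`), `σ` a continuous isometric involution,
`J` hermitian with `det J ≠ 0`; `γ ∈ U(σ, J)` with frame `γ P = P·reindex e (a·1_m ⊕ u·1₁)`, `a ≠ u`, `u σ(u) = 1`; `v₁ = P e_{inr 0}`.  In the frame every
`t ∈ Z_U(γ)` is `P(B_t ⊕ λ_t)P⁻¹` with `B_t`, `λ_t` CONTINUOUS in `t` (★ `conj_eq_fromBlocks_of_commute`; `B_t = (P⁻¹ t P)₁₁`), `χ_t = (X − λ_t)·χ_{B_t}`, `λ_t σ(λ_t) = 1`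
(⊙ A1).  WINDOW: with `r := ‖u − a‖∕2`, the set `W = {t ∣ ‖λ_t − u‖ < r, ∀ l ∈ B̄(u, r): χ_{B_t}(l) ≠ 0}` is a neighbourhood of `γ` in `Z_U(γ)` (tube lemma over the compact
ball; at `γ`: `χ_{B_γ}(l) = (l − a)^{|m|} ≠ 0`), and ★ (D1c)'s box clause supplies a COMPACT-OPEN `B₁ ⊆ W` containing `γ`.  Then
`𝒩 := {ω ∣ ∃ t ∈ B₁, χ_ω = χ_t}` is CLOSED (projection along the compact `B₁` of a closed coefficient relation), conjugation-invariant, and has ★ p841422's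
SIMPLICITY property with `Λ₀ := {l ∣ lσl = 1} ∩ B̄(u, r)`; ★ p841422 + ⊙ A1 `commute_of_mulVec_frameVec_eq` give the head
**`exists_isCompact_isOpen_nhds_conj_mem_imp_commute`**: `∃ B₁` compact open `∋ γ` in `Z_U(γ)`, `∀ Ω` compact, `∃ C ⊆ U` compact, `∀ x ∈ U`, `∀ t ∈ B₁`,
`x t x⁻¹ ∈ Ω ⇒ ∃ c ∈ C`, `c⁻¹ x ∈ Z_U(γ)`.

HONEST SCOPE.  Field level; the CM dress on `(cmDatum L 3 H′).Local v` is FILE B.  HC_CM is proved only modulo the printed citations until rung 0 closes.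

## References
* [HarishChandra1970] Harish-Chandra (notes by G. van Dijk), *Harmonic Analysis on Reductive p-adic Groups*, LNM 162 (1970), Part I §3 Lemma 19 + Corollary; Part II §5.
* [Rogawski1990] J. D. Rogawski, *Automorphic Representations of Unitary Groups in Three Variables*, Ann. of Math. Stud. 123 (1990), §8.2 Prop. 8.2.1 pp. 112–116.
-/

set_option autoImplicit false

noncomputable section

open Set Filter Topology Matrix Polynomial

namespace Literature.NumberTheory.Automorphic.UnitaryGroup

open Literature.LinearAlgebra.Matrix Literature.Analysis.Calculus

variable {E : Type*} [NontriviallyNormedField E] [CompleteSpace E] {n m : Type*} [Fintype n] [DecidableEq n] [Fintype m] [DecidableEq m]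
  (σ : E →+* E) (J : Matrix n n E)

omit [CompleteSpace E] [DecidableEq m] [Fintype m] in
/-- Two square matrices have the same characteristic polynomial iff their first `|n| + 1` coefficients agree. [folklore] -/
private theorem charpoly_eq_iff_coeff {A B : Matrix n n E} :
    A.charpoly = B.charpoly ↔ ∀ k : Fin (Fintype.card n + 1), A.charpoly.coeff k = B.charpoly.coeff k := by
  refine ⟨fun h k => by rw [h], fun h => Polynomial.ext fun k => ?_⟩
  by_cases hk : k < Fintype.card n + 1
  · exact h ⟨k, hk⟩
  · have hA : A.charpoly.coeff k = 0 := Polynomial.coeff_eq_zero_of_natDegree_lt (by rw [Matrix.charpoly_natDegree_eq_dim]; omega)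
    have hB : B.charpoly.coeff k = 0 := Polynomial.coeff_eq_zero_of_natDegree_lt (by rw [Matrix.charpoly_natDegree_eq_dim]; omega)
    rw [hA, hB]

omit [CompleteSpace E] [Fintype n] [DecidableEq n] [DecidableEq m] [Fintype m] in
/-- `(t, l) ↦ χ_{B(t)}(l)` is jointly continuous when `B` is (finite sum of continuous coefficient functions times powers). [folklore] -/
private theorem continuous_eval_charpoly_comp {X : Type*} [TopologicalSpace X] {k : Type*} [Fintype k] [DecidableEq k] {B : X → Matrix k k E}
    (hB : Continuous B) : Continuous fun p : X × E => (B p.1).charpoly.eval p.2 := by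
  have h : ∀ p : X × E, (B p.1).charpoly.eval p.2 = ∑ i ∈ Finset.range (Fintype.card k + 1), (B p.1).charpoly.coeff i * p.2 ^ i := fun p =>
    Polynomial.eval_eq_sum_range' (by rw [Matrix.charpoly_natDegree_eq_dim]; exact Nat.lt_succ_self _) _
  simp_rw [h]
  exact continuous_finsetSum _ fun i _ => (((continuous_charpoly_coeff i).comp (hB.comp continuous_fst)).mul (continuous_snd.pow i))

/-- **HARISH-CHANDRA'S COMPACTNESS MOD `Z_U(γ)` AT A BLOCK-SCALAR UNITARY `γ`, WINDOW INTERNAL.**  See the module docstring.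
[cite: HarishChandra1970, Part I §3 Lemma 19; Part II §5] [cite: Rogawski1990, §8.2 Prop. 8.2.1 pp. 112–116] -/
theorem exists_isCompact_isOpen_nhds_conj_mem_imp_commute [CharZero E] [ProperSpace E] [TotallyDisconnectedSpace E]
    (hσ : ∀ s, σ (σ s) = s) (hσc : Continuous σ) (hσi : ∀ x, ‖σ x‖ = ‖x‖) (hH : (J.map σ)ᵀ = J) (hJd : J.det ≠ 0)
    (γ : ↥(unitaryGroupOfForm σ J)) {P : GL n E} {e : m ⊕ Fin 1 ≃ n} {a u : E} (hau : a ≠ u) (hu1 : u * σ u = 1)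
    (hP : ((γ : GL n E) : Matrix n n E) * P.val = P.val * Matrix.reindex e e (Matrix.fromBlocks (a • (1 : Matrix m m E)) 0 0 (u • (1 : Matrix (Fin 1) (Fin 1) E)))) :
    ∃ B₁ : Set ↥(Subgroup.centralizer ({γ} : Set ↥(unitaryGroupOfForm σ J))), IsCompact B₁ ∧ IsOpen B₁ ∧
      (⟨γ, Subgroup.mem_centralizer_singleton_iff.2 rfl⟩ : ↥(Subgroup.centralizer ({γ} : Set ↥(unitaryGroupOfForm σ J)))) ∈ B₁ ∧
      ∀ Ω : Set (Matrix n n E), IsCompact Ω → ∃ C : Set ↥(unitaryGroupOfForm σ J), IsCompact C ∧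
        ∀ x : ↥(unitaryGroupOfForm σ J), ∀ t ∈ B₁,
          (((x * (t : ↥(unitaryGroupOfForm σ J)) * x⁻¹ : ↥(unitaryGroupOfForm σ J)) : GL n E) : Matrix n n E) ∈ Ω →
          ∃ c ∈ C, Commute ((((c⁻¹ * x : ↥(unitaryGroupOfForm σ J))) : GL n E) : Matrix n n E) ((γ : GL n E) : Matrix n n E) := by
  classical
  have hJ : IsUnit J.det := Ne.isUnit hJd
  have h2 : (2 : E) ≠ 0 := two_ne_zero
  set v₁ : n → E := P.val *ᵥ Pi.single (e (Sum.inr 0)) 1 with hv₁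
  have hβ : hermForm σ J v₁ v₁ ≠ 0 := hermForm_frameVec_ne_zero σ J hJd γ.2 hP hau hu1
  -- the frame map and the continuous block data `B_t`, `λ_t`
  let Ψ : Matrix n n E → Matrix (m ⊕ Fin 1) (m ⊕ Fin 1) E := fun X => Matrix.reindex e.symm e.symm ((P⁻¹).val * X * P.val)
  have hΨc : Continuous Ψ := ((continuous_const.mul continuous_id).mul continuous_const).matrix_submatrix _ _
  let coeT : ↥(Subgroup.centralizer ({γ} : Set ↥(unitaryGroupOfForm σ J))) → Matrix n n E := fun t => (((t : ↥(unitaryGroupOfForm σ J)) : GL n E) : Matrix n n E)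
  have hcoeT : Continuous coeT := (Units.continuous_val.comp continuous_subtype_val).comp continuous_subtype_val
  let Bt : ↥(Subgroup.centralizer ({γ} : Set ↥(unitaryGroupOfForm σ J))) → Matrix m m E := fun t => (Ψ (coeT t)).toBlocks₁₁
  let lt : ↥(Subgroup.centralizer ({γ} : Set ↥(unitaryGroupOfForm σ J))) → E := fun t => (Ψ (coeT t)) (Sum.inr 0) (Sum.inr 0)
  have hBtc : Continuous Bt := ((hΨc.comp hcoeT).matrix_submatrix Sum.inl Sum.inl)
  have hltc : Continuous lt := (continuous_apply_apply (Sum.inr 0) (Sum.inr 0)).comp (hΨc.comp hcoeT)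
  -- block structure of centraliser elements
  have hAC : ∀ X : Matrix m (Fin 1) E, a • (1 : Matrix m m E) * X = X * (u • (1 : Matrix (Fin 1) (Fin 1) E)) → X = 0 := fun X hX => by
    rw [Matrix.smul_mul, Matrix.one_mul, Matrix.mul_smul, Matrix.mul_one, ← sub_eq_zero, ← sub_smul, smul_eq_zero] at hX
    exact hX.resolve_left (sub_ne_zero.2 hau)
  have hCA : ∀ Y : Matrix (Fin 1) m E, u • (1 : Matrix (Fin 1) (Fin 1) E) * Y = Y * (a • (1 : Matrix m m E)) → Y = 0 := fun Y hY => by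
    rw [Matrix.smul_mul, Matrix.one_mul, Matrix.mul_smul, Matrix.mul_one, ← sub_eq_zero, ← sub_smul, smul_eq_zero] at hY
    exact hY.resolve_left (sub_ne_zero.2 hau.symm)
  have hcomm : ∀ t : ↥(Subgroup.centralizer ({γ} : Set ↥(unitaryGroupOfForm σ J))), Commute (coeT t) ((γ : GL n E) : Matrix n n E) := fun t => by
    have h := Subgroup.mem_centralizer_singleton_iff.1 t.2
    have h' := congrArg (fun g : ↥(unitaryGroupOfForm σ J) => ((g : GL n E) : Matrix n n E)) h
    simp only [Subgroup.coe_mul, Units.val_mul] at h'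
    exact h'
  have hblock : ∀ t : ↥(Subgroup.centralizer ({γ} : Set ↥(unitaryGroupOfForm σ J))),
      coeT t *ᵥ v₁ = lt t • v₁ ∧ (coeT t).charpoly = (X - C (lt t)) * (Bt t).charpoly := by
    intro t
    obtain ⟨B, D, -, -, hBD⟩ := conj_eq_fromBlocks_of_commute hP hAC hCA (hcomm t)
    have hΨt : Ψ (coeT t) = Matrix.fromBlocks B 0 0 D := by
      show Matrix.reindex e.symm e.symm ((P⁻¹).val * coeT t * P.val) = _
      rw [hBD]; ext i j; simp only [Matrix.reindex_apply, Matrix.submatrix_apply, Equiv.symm_symm, Equiv.symm_apply_apply]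
    have hB : Bt t = B := by show (Ψ (coeT t)).toBlocks₁₁ = B; rw [hΨt, Matrix.toBlocks_fromBlocks₁₁]
    have hl : lt t = D 0 0 := by show (Ψ (coeT t)) (Sum.inr 0) (Sum.inr 0) = D 0 0; rw [hΨt, Matrix.fromBlocks_apply₂₂]
    obtain ⟨B', l', htv, hχ⟩ := exists_blocks_of_commute (K := E) hP hau (hcomm t)
    -- identify `l' = D 0 0` and `B'.charpoly = B.charpoly` through the explicit conjugate
    have ht' : coeT t = P.val * Matrix.reindex e e (Matrix.fromBlocks B 0 0 D) * P.val⁻¹ := by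
      rw [← hBD]
      rw [show P.val * ((P⁻¹).val * coeT t * P.val) * P.val⁻¹ = (P.val * (P⁻¹).val) * coeT t * (P.val * P.val⁻¹) by simp only [Matrix.mul_assoc],
        ← Units.val_mul, mul_inv_cancel, Units.val_one, Matrix.one_mul,
        Matrix.mul_nonsing_inv _ ((Matrix.isUnit_iff_isUnit_det _).1 (Units.isUnit P)), Matrix.mul_one]
    have hD : D = (D 0 0) • (1 : Matrix (Fin 1) (Fin 1) E) := by
      ext i j
      have hi : i = 0 := Subsingleton.elim _ _
      have hj : j = 0 := Subsingleton.elim _ _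
      subst hi; subst hj
      rw [Matrix.smul_apply, Matrix.one_apply_eq, smul_eq_mul, mul_one]
    refine ⟨?_, ?_⟩
    · have h1 : (P.val)⁻¹ *ᵥ (P.val *ᵥ Pi.single (e (Sum.inr 0)) (1 : E)) = Pi.single (e (Sum.inr 0)) 1 := by
        rw [Matrix.mulVec_mulVec, Matrix.nonsing_inv_mul _ ((Matrix.isUnit_iff_isUnit_det _).1 (Units.isUnit P)), Matrix.one_mulVec]
      have h2 : Matrix.reindex e e (Matrix.fromBlocks B 0 0 D) *ᵥ Pi.single (e (Sum.inr 0)) 1 = (D 0 0) • Pi.single (e (Sum.inr 0)) 1 := by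
        rw [hD, Matrix.smul_apply, Matrix.one_apply_eq, smul_eq_mul, mul_one]
        have hgen := reindex_fromBlocks_mulVec_single (K := E) e (0 : E) (D 0 0) (Sum.inr 0)
        rw [zero_smul, Sum.elim_inr] at hgen
        -- `fromBlocks B 0 0 (d•1)` and `fromBlocks 0 0 0 (d•1)` agree on the last column
        rw [← hgen]
        ext i
        rw [Matrix.mulVec_single_one, Matrix.mulVec_single_one, Matrix.col_apply, Matrix.col_apply]
        obtain ⟨j, rfl⟩ := e.surjective i
        rw [Matrix.reindex_apply, Matrix.reindex_apply, Matrix.submatrix_apply, Matrix.submatrix_apply, Equiv.symm_apply_apply, Equiv.symm_apply_apply]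
        rcases j with j | j
        · rw [Matrix.fromBlocks_apply₁₂, Matrix.fromBlocks_apply₁₂]
        · rw [Matrix.fromBlocks_apply₂₂, Matrix.fromBlocks_apply₂₂]
      rw [hl, hv₁, ht', ← Matrix.mulVec_mulVec, ← Matrix.mulVec_mulVec, h1, h2, Matrix.mulVec_smul]
    · have hχD : D.charpoly = X - C (D 0 0) := by
        conv_lhs => rw [hD, Matrix.smul_one_eq_diagonal, Matrix.charpoly_diagonal]
        rw [Finset.prod_const, Finset.card_univ, Fintype.card_fin, pow_one]
      rw [hB, hl, ht', Matrix.charpoly_units_conj, Matrix.charpoly_reindex, Matrix.charpoly_fromBlocks_zero₁₂, hχD, mul_comm]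
  -- the base point
  set t₀ : ↥(Subgroup.centralizer ({γ} : Set ↥(unitaryGroupOfForm σ J))) := ⟨γ, Subgroup.mem_centralizer_singleton_iff.2 rfl⟩ with ht₀
  have hΨγ : Ψ (coeT t₀) = Matrix.fromBlocks (a • (1 : Matrix m m E)) 0 0 (u • (1 : Matrix (Fin 1) (Fin 1) E)) := by
    show Matrix.reindex e.symm e.symm ((P⁻¹).val * ((γ : GL n E) : Matrix n n E) * P.val) = _
    rw [Matrix.mul_assoc, hP, ← Matrix.mul_assoc, ← Units.val_mul, inv_mul_cancel, Units.val_one, Matrix.one_mul]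
    ext i j; simp only [Matrix.reindex_apply, Matrix.submatrix_apply, Equiv.symm_symm, Equiv.symm_apply_apply]
  have hBt₀ : Bt t₀ = a • (1 : Matrix m m E) := by show (Ψ (coeT t₀)).toBlocks₁₁ = _; rw [hΨγ, Matrix.toBlocks_fromBlocks₁₁]
  have hlt₀ : lt t₀ = u := by
    show (Ψ (coeT t₀)) (Sum.inr 0) (Sum.inr 0) = u
    rw [hΨγ, Matrix.fromBlocks_apply₂₂, Matrix.smul_apply, Matrix.one_apply_eq, smul_eq_mul, mul_one]
  -- the window
  set r : ℝ := ‖u - a‖ / 2 with hr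
  have hr0 : 0 < r := by rw [hr]; exact half_pos (norm_pos_iff.2 (sub_ne_zero.2 (Ne.symm hau)))
  have hball : ∀ l ∈ Metric.closedBall u r, l ≠ a := by
    intro l hl hla
    rw [Metric.mem_closedBall, dist_eq_norm, hla, norm_sub_rev] at hl
    have : ‖u - a‖ ≤ ‖u - a‖ / 2 := hl
    linarith [norm_pos_iff.2 (sub_ne_zero.2 (Ne.symm hau))]
  have hW : ∀ᶠ t in 𝓝 t₀, ‖lt t - u‖ < r ∧ ∀ l ∈ Metric.closedBall u r, (Bt t).charpoly.eval l ≠ 0 := by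
    refine (?_ : ∀ᶠ t in 𝓝 t₀, ‖lt t - u‖ < r).and ?_
    · have hc : Continuous fun t => ‖lt t - u‖ := (hltc.sub continuous_const).norm
      have h0 : ‖lt t₀ - u‖ < r := by rw [hlt₀, sub_self, norm_zero]; exact hr0
      exact hc.continuousAt.eventually_lt continuous_const.continuousAt h0
    · refine (isCompact_closedBall u r).eventually_forall_of_forall_eventually fun l hl => ?_
      have hc : Continuous fun p : ↥(Subgroup.centralizer ({γ} : Set ↥(unitaryGroupOfForm σ J))) × E => (Bt p.1).charpoly.eval p.2 :=
        continuous_eval_charpoly_comp hBtc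
      have h0 : (Bt t₀).charpoly.eval l ≠ 0 := by
        rw [hBt₀, Matrix.smul_one_eq_diagonal, Matrix.charpoly_diagonal, Polynomial.eval_prod]
        exact Finset.prod_ne_zero_iff.2 fun i _ => by rw [eval_sub, eval_X, eval_C]; exact sub_ne_zero.2 (hball l hl)
      exact (hc.continuousAt (x := (t₀, l))).eventually_ne h0
  obtain ⟨W, hWsub, hWo, hWt₀⟩ := mem_nhds_iff.1 hW
  -- a compact-open `B₁ ∋ t₀` inside `W`, from ★ (D1c)'s box clause
  obtain ⟨s, eT, a₀, t₀', -, -, -, -, ht₀', hsrc, -, hbox⟩ := exists_unitary_sliceDatum σ hσc hJ γ hau P e hP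
  have ht₀eq : t₀' = t₀ := Subtype.ext (by rw [ht₀', ht₀])
  obtain ⟨K, B₁, -, -, haK, hB₁c, hB₁o, htB, hKBN, -, -, -⟩ := hbox (univ ×ˢ W) (by
    rw [ht₀eq] at hsrc ⊢; exact prod_mem_nhds univ_mem (hWo.mem_nhds hWt₀))
  have hB₁W : B₁ ⊆ W := fun t ht => (hKBN (mk_mem_prod haK ht)).2
  refine ⟨B₁, hB₁c, hB₁o, ht₀eq ▸ htB, fun Ω hΩ => ?_⟩
  -- the window set `𝒩` and `Λ₀`
  haveI : CompactSpace ↥B₁ := isCompact_iff_compactSpace.1 hB₁c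
  let cv : Matrix n n E → (Fin (Fintype.card n + 1) → E) := fun A k => A.charpoly.coeff k
  have hcvc : Continuous cv := continuous_pi fun k => continuous_charpoly_coeff (k : ℕ)
  set 𝒩 : Set (Matrix n n E) := {ω | ∃ t ∈ B₁, ω.charpoly = (coeT t).charpoly} with hN
  have hNc : IsClosed 𝒩 := by
    have hrel : IsClosed {p : ↥B₁ × Matrix n n E | cv p.2 = cv (coeT (p.1 : _))} :=
      isClosed_eq (hcvc.comp continuous_snd) (hcvc.comp (hcoeT.comp (continuous_subtype_val.comp continuous_fst)))
    have himg : 𝒩 = Prod.snd '' {p : ↥B₁ × Matrix n n E | cv p.2 = cv (coeT (p.1 : _))} := by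
      ext ω
      constructor
      · rintro ⟨t, ht, h⟩
        refine ⟨(⟨t, ht⟩, ω), ?_, rfl⟩
        show cv ω = cv (coeT t)
        funext k; exact (charpoly_eq_iff_coeff.1 h) k
      · rintro ⟨⟨t, ω'⟩, h, rfl⟩
        exact ⟨t, t.2, charpoly_eq_iff_coeff.2 fun k => congrFun h k⟩
    rw [himg]
    exact isClosedMap_snd_of_compactSpace _ hrel
  set Λ₀ : Set E := {l | l * σ l = 1} ∩ Metric.closedBall u r with hΛ₀
  have hΛc : IsCompact Λ₀ := (isCompact_closedBall u r).inter_left (isClosed_eq (continuous_id.mul hσc) continuous_const)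
  have hΛ : ∀ l ∈ Λ₀, l * σ l = 1 := fun l hl => hl.1
  -- SIMPLICITY on `𝒩 × Λ₀`
  have hsimple : ∀ ω ∈ 𝒩, ∀ g ∈ unitaryGroupOfForm σ J, (g : Matrix n n E) = ω → ∀ l ∈ Λ₀, ∀ v : n → E, v ≠ 0 → ω *ᵥ v = l • v →
      ∃ q : E[X], ω.charpoly = (X - C l) * q ∧ q.eval l ≠ 0 := by
    rintro ω ⟨t, htB, hχω⟩ g - rfl l hl v hv0 hv
    obtain ⟨-, hχt⟩ := hblock t
    have hWt := hWsub (hB₁W htB)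
    -- `l` is a root of `χ_ω = (X − λ_t) χ_{B_t}`
    have hroot : ((g : Matrix n n E)).charpoly.IsRoot l := by
      rw [← Matrix.charpoly_toLin', ← Module.End.hasEigenvalue_iff_isRoot_charpoly]
      exact Module.End.hasEigenvalue_of_hasEigenvector ⟨by rw [Module.End.mem_eigenspace_iff, Matrix.toLin'_apply]; exact hv, hv0⟩
    rw [hχω, hχt, Polynomial.IsRoot, eval_mul, eval_sub, eval_X, eval_C, mul_eq_zero] at hroot
    have hq : (Bt t).charpoly.eval l ≠ 0 := hWt.2 l hl.2
    have hl' : l = lt t := by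
      rcases hroot with h | h
      · exact sub_eq_zero.1 h
      · exact absurd h hq
    refine ⟨(Bt t).charpoly, ?_, hq⟩
    rw [hχω, hχt, hl']
  -- ★ (F-asm)
  obtain ⟨C, hCc, hC⟩ := exists_isCompact_conj_mem_imp_mem_mul_stab σ J hσ hσc hσi hH hJd h2 hβ hΛc hΛ hNc hsimple hΩ
  refine ⟨C, hCc, fun x t htB hxt => ?_⟩
  have hWt := hWsub (hB₁W htB)
  obtain ⟨l, q, htv, hl1, -⟩ := exists_eigen_of_commute σ J hJd γ.2 hP hau hu1 (t : ↥(unitaryGroupOfForm σ J)).2 (hcomm t)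
  -- `l = λ_t ∈ Λ₀`
  have hl' : l = lt t := by
    have h := htv.symm.trans (hblock t).1
    exact smul_left_injective E (frameVec_ne_zero (K := E)) h |> fun h' => by exact h'
  have hlΛ : l ∈ Λ₀ := ⟨hl1, by rw [hl', Metric.mem_closedBall, dist_eq_norm]; exact hWt.1.le⟩
  have hN : (((x * (t : ↥(unitaryGroupOfForm σ J)) * x⁻¹ : ↥(unitaryGroupOfForm σ J)) : GL n E) : Matrix n n E) ∈ 𝒩 := by
    refine ⟨t, htB, ?_⟩
    rw [Subgroup.coe_mul, Subgroup.coe_mul, Units.val_mul, Units.val_mul, Subgroup.coe_inv, Matrix.coe_units_inv]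
    exact Matrix.charpoly_units_conj _ _
  obtain ⟨c, hcC, hcv⟩ := hC x (t : ↥(unitaryGroupOfForm σ J)) ⟨l, hlΛ, htv⟩ ⟨hxt, hN⟩
  exact ⟨c, hcC, commute_of_mulVec_frameVec_eq σ J hJd γ.2 hP hau hu1 (c⁻¹ * x).2 hcv⟩

end Literature.NumberTheory.Automorphic.UnitaryGroup
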